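import Summits.AtomisticToContinuum.Crystallization.Theorems.FrustratedLawDichotomyAperiodicGapRecordJunctionFourSectorStepPairQuot

/-!
# FrustratedLawDichotomy · crux `AperiodicFrustratedLawGap` (stmt-AtomisticToContinuum-27623) — THE N-CELLS AT STEPPED TABLES FROM THE KERNEL CUT WITH A
# GENERIC BALANCE `𝓑` AND A GENERIC REFIT `(τ₁, T₁)` (critic row 1629 (MB): the MOMENT balance `momentBal r` replaces `rotBalanced r` as the refit balance of record —
# so no instrumented N-cell may be pinned to `balTop`), and the 27623 consumer over them
# (decomp-a2c hand 2, generation 43; structural #40 = the balance-generic edition of #36 §3/§5 and of #37 §3; DEF-FREE)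

#36's instrumented N-cells (`refineGB_ND_collar_of_kernelCut_top`, `refineGB_stepPair_of_kernelCut_top_pos/_neg`, `refineGB_bandLo/Hi_stepPair_of_kernelCut_top`) use the
IDENTITY refit `balTop`.  The tree's root is balance- and refit-GENERIC (`…KernelCutSector.refineGB_of_kernelCut_mono`: refit source `𝓘_N`, target `𝓘₁`, balance `𝓑`,
refit data `(τ₁, T₁)`, hull `𝓗 ⊇ 𝓘₁`); this file is that root read at stepped tables, most general first:

* §1 (B-, 𝓑-, refit-generic) `refineGB_stepPair_of_kernelCut_pos/_neg`, `refineGB_bandLo/Hi_stepPair_of_kernelCut` — certificate on the TARGET class family at its OWN table,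
  N-cell at the stepped / nested-stepped table for ANY refit source `𝓘_N`.
* §2 (collar of record, self-refit `𝓘_N = 𝓘₁ =` the door family, literals `(26/5, 1/100, 1/8, 1/25)`) ★★ `refineGB_ND_collar_of_kernelCut` (any `𝓑`, `(τ₁, T₁)`; the `balTop`
  member is #36's `…_top`), `refineGB_NBlo_collar_of_kernelCut`.
* §3 ★★★ the consumer `aperiodicFrustratedLawGap_of_semOKF_semOKHQ_fourSector_collar_kernelCut_A35000_T26_record` — (N∣𝔇′)ᴸ via (R 𝓑) ∧ (E κ) ∧ (P₀ κ) on the door family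
  with ANY balance/refit (e.g. `momentBal`), (N∣𝔅lo) likewise with its own `𝓑′`; quotient H-currency; the table-generic sibling `…_fourSector_stepPair_kernelCut_…`.

* §4 (appended, g43; lens-5 g102 FINDING REFIT-102 / DOOR T) refit TARGET generic: `refineGB_ND_collar_of_kernelCut_target`, `refineGB_NBlo_collar_of_kernelCut_target`,
  ★★★ `…_fourSector_collar_kernelCutT_…` (certificate/enclosure on ANY target `famAnd 𝓙 𝓡` / low-band-shaped target; self-refit = §2/§3).

One-line compositions of landed theorems; 0 sorry; no definitions; standard axioms.  `--supports stmt-AtomisticToContinuum-27623`.  [folklore instantiation]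
-/

noncomputable section

open scoped BigOperators Classical RealInnerProductSpace
open Literature.Analysis.ValidatedNumerics.Numerics
open Summit.AtomisticToContinuum.Crystallization.Theorems.ChargedEnergyGapNegative (eStar E3)
open Summit.AtomisticToContinuum.Crystallization.Theorems.FrustratedLawDichotomyRangeCut
open Summit.AtomisticToContinuum.Crystallization.Theorems.FrustratedLawDichotomySchurCut
open Summit.AtomisticToContinuum.Crystallization.Theorems.FrustratedLawDichotomyMotifLemmas (GoodAtScale)
open Summit.AtomisticToContinuum.Crystallization.Theorems.FrustratedLawDichotomyAveragingCut (ballAvg)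
open Summit.AtomisticToContinuum.Crystallization.Theorems.FrustratedLawDichotomyExemptLocOpt (LocOptFails)
open Summit.AtomisticToContinuum.Crystallization.Theorems.FrustratedLawDichotomyExemptSplit (SchurElasticPricingX)
open Summit.AtomisticToContinuum.Crystallization.Theorems.FrustratedLawDichotomyExemptAbsorptionRecord
open Summit.AtomisticToContinuum.Crystallization.Theorems.FrustratedLawDichotomyCollarCensus
open Summit.AtomisticToContinuum.Crystallization.Theorems.FrustratedLawDichotomyCollarCensusKappa
open Summit.AtomisticToContinuum.Crystallization.Theorems.FrustratedLawDichotomyStrainedPatchHomSplit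
open Summit.AtomisticToContinuum.Crystallization.Theorems.FrustratedLawDichotomyStrainedPatchCleanCollar (CleanBall TailPenalty AnnularDefectFloor
  DefectiveCollarFloor tailOut)
open Summit.AtomisticToContinuum.Crystallization.Theorems.FrustratedLawDichotomyStrainedPatchPhaseCut (MonoPhaseBall AnnularPhaseFloor PolyTextureFloor)
open Summit.AtomisticToContinuum.Crystallization.Theorems.FrustratedLawDichotomyStrainedPatchCoreTube (NearHomIsoAt CoreOffTubeFloor RimOffTubeFloor)
open Summit.AtomisticToContinuum.Crystallization.Theorems.FrustratedLawDichotomyStrainedPatchCoreTubeRecord (CoreCoreRelief)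
open Summit.AtomisticToContinuum.Crystallization.Theorems.FrustratedLawDichotomyStrainedPatchChartFamilies (ChartBy FamilyLE familyLE_refl)
open Summit.AtomisticToContinuum.Crystallization.Theorems.FrustratedLawDichotomyStrainedPatchQuantSlaving
open Summit.AtomisticToContinuum.Crystallization.Theorems.FrustratedLawDichotomyStrainedPatchHostCells (TubeFloor)
open Summit.AtomisticToContinuum.Crystallization.Theorems.FrustratedLawDichotomyStrainedPatchGradedTube
open Summit.AtomisticToContinuum.Crystallization.Theorems.FrustratedLawDichotomyStrainedPatchCoverBridge
open Summit.AtomisticToContinuum.Crystallization.Theorems.FrustratedLawDichotomyStrainedPatchPairTube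
open Summit.AtomisticToContinuum.Crystallization.Theorems.FrustratedLawDichotomyStrainedPatchKernelCut
open Summit.AtomisticToContinuum.Crystallization.Theorems.FrustratedLawDichotomyStrainedPatchHomCertTree (CertTree treeOK)
open Summit.AtomisticToContinuum.Crystallization.Theorems.FrustratedLawDichotomyStrainedPatchHomEntryGram (rootC rootW)
open Summit.AtomisticToContinuum.Crystallization.Theorems.FrustratedLawDichotomyStrainedPatchHomEntryLeafHT (entryLeafOK6RBKP4 semOKH semOKF)
open Summit.AtomisticToContinuum.Crystallization.Theorems.FrustratedLawDichotomyStrainedPatchHomEntrySemanticQuot (semOKHQ rootCHQ rootWHQ)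
open Summit.AtomisticToContinuum.Crystallization.Theorems.FrustratedLawDichotomyAperiodicGapRecordJunctionHomFloorF6pT26
open Summit.AtomisticToContinuum.Crystallization.Theorems.FrustratedLawDichotomyStrainedPatchConeAnatomy
open Summit.AtomisticToContinuum.Crystallization.Theorems.FrustratedLawDichotomyStrainedPatchStiffSector
open Summit.AtomisticToContinuum.Crystallization.Theorems.FrustratedLawDichotomyStrainedPatchStiffDoor
open Summit.AtomisticToContinuum.Crystallization.Theorems.FrustratedLawDichotomyStrainedPatchKernelCutSector
open Summit.AtomisticToContinuum.Crystallization.Theorems.FrustratedLawDichotomyStrainedPatchShearDoor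
open Summit.AtomisticToContinuum.Crystallization.Theorems.FrustratedLawDichotomyStrainedPatchPairTubeCollar
open Summit.AtomisticToContinuum.Crystallization.Theorems.FrustratedLawDichotomyAperiodicGapRecordJunctionFourSectorCollar
open Summit.AtomisticToContinuum.Crystallization.Theorems.FrustratedLawDichotomyAperiodicGapRecordJunctionFourSectorCollarQuot
  (aperiodicFrustratedLawGap_of_semOKF_semOKHQ_fourSector_collar_A35000_T26_record)
open Summit.AtomisticToContinuum.Crystallization.Theorems.FrustratedLawDichotomyAperiodicGapRecordJunctionFourSectorStepPairQuot
  (aperiodicFrustratedLawGap_of_semOKF_semOKHQ_fourSector_stepPair_A35000_T26_record)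

namespace Summit.AtomisticToContinuum.Crystallization.Theorems.FrustratedLawDichotomyAperiodicGapRecordJunctionStepPairKernelCut

/-! ## §1. Balance-, refit- and table-generic instrumented N-cells at stepped tables -/

section Generic

variable {𝓘_N 𝓙 𝓗 𝓡 𝓟 : ChartFam} {𝓑 : BalPred} {ρ ε η₂ τ₀ τ₁ τ κ σ : ℝ} {T₀ T₁ T : SlackTab} {H : HessTab} {F : ForceTab} {X : SlackTab}
  {B₁ B₂ B₃ : PairTab}

/-- ★★ (N) at the stepped table `stepPair 𝓡 B₁ B₂` from (R 𝓑) refitting `𝓘_N` into the class family `famAnd 𝓙 𝓡` ∧ (E κ) ∧ (P₀ κ) there AT ITS OWN TABLE `B₁`; any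
balance, refit data, hull `𝓗 ⊇ famAnd 𝓙 𝓡`. [folklore instantiation: `refineGB_of_kernelCut_mono` at #36 `pairKernelCert_stepPair_of_pos`] -/
theorem refineGB_stepPair_of_kernelCut_pos (h𝓗 : FamilyLE (famAnd 𝓙 𝓡) 𝓗) (hR : BalancedRefit 𝓘_N (famAnd 𝓙 𝓡) 𝓑 ρ ε η₂ τ₀ T₀ τ₁ T₁)
    (hE : SlavingEnclosureG (famAnd 𝓙 𝓡) 𝓑 ρ ε η₂ τ₁ T₁ κ σ H F X) (hP : PairKernelCert (famAnd 𝓙 𝓡) 𝓑 τ₁ T₁ κ σ H F X τ T B₁) :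
    RefineGB 𝓘_N 𝓗 ρ ε η₂ τ₀ T₀ τ T (stepPair 𝓡 B₁ B₂) :=
  refineGB_of_kernelCut_mono h𝓗 hR hE (pairKernelCert_stepPair_of_pos hP)

/-- … into the complement family `famAndNot 𝓙 𝓡` at its own table `B₂`. [folklore instantiation] -/
theorem refineGB_stepPair_of_kernelCut_neg (h𝓗 : FamilyLE (famAndNot 𝓙 𝓡) 𝓗) (hR : BalancedRefit 𝓘_N (famAndNot 𝓙 𝓡) 𝓑 ρ ε η₂ τ₀ T₀ τ₁ T₁)
    (hE : SlavingEnclosureG (famAndNot 𝓙 𝓡) 𝓑 ρ ε η₂ τ₁ T₁ κ σ H F X) (hP : PairKernelCert (famAndNot 𝓙 𝓡) 𝓑 τ₁ T₁ κ σ H F X τ T B₂) :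
    RefineGB 𝓘_N 𝓗 ρ ε η₂ τ₀ T₀ τ T (stepPair 𝓡 B₁ B₂) :=
  refineGB_of_kernelCut_mono h𝓗 hR hE (pairKernelCert_stepPair_of_neg hP)

/-- … into the low band `famAnd (famAndNot 𝓙 𝓡) 𝓟` at its own table `B₂` under the nested table `stepPair 𝓡 B₁ (stepPair 𝓟 B₂ B₃)`. [folklore instantiation] -/
theorem refineGB_bandLo_stepPair_of_kernelCut (h𝓗 : FamilyLE (famAnd (famAndNot 𝓙 𝓡) 𝓟) 𝓗)
    (hR : BalancedRefit 𝓘_N (famAnd (famAndNot 𝓙 𝓡) 𝓟) 𝓑 ρ ε η₂ τ₀ T₀ τ₁ T₁)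
    (hE : SlavingEnclosureG (famAnd (famAndNot 𝓙 𝓡) 𝓟) 𝓑 ρ ε η₂ τ₁ T₁ κ σ H F X)
    (hP : PairKernelCert (famAnd (famAndNot 𝓙 𝓡) 𝓟) 𝓑 τ₁ T₁ κ σ H F X τ T B₂) :
    RefineGB 𝓘_N 𝓗 ρ ε η₂ τ₀ T₀ τ T (stepPair 𝓡 B₁ (stepPair 𝓟 B₂ B₃)) :=
  refineGB_of_kernelCut_mono h𝓗 hR hE (pairKernelCert_bandLo_stepPair hP)

/-- … into the high band `famAndNot (famAndNot 𝓙 𝓡) 𝓟` at its own table `B₃`. [folklore instantiation] -/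
theorem refineGB_bandHi_stepPair_of_kernelCut (h𝓗 : FamilyLE (famAndNot (famAndNot 𝓙 𝓡) 𝓟) 𝓗)
    (hR : BalancedRefit 𝓘_N (famAndNot (famAndNot 𝓙 𝓡) 𝓟) 𝓑 ρ ε η₂ τ₀ T₀ τ₁ T₁)
    (hE : SlavingEnclosureG (famAndNot (famAndNot 𝓙 𝓡) 𝓟) 𝓑 ρ ε η₂ τ₁ T₁ κ σ H F X)
    (hP : PairKernelCert (famAndNot (famAndNot 𝓙 𝓡) 𝓟) 𝓑 τ₁ T₁ κ σ H F X τ T B₃) :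
    RefineGB 𝓘_N 𝓗 ρ ε η₂ τ₀ T₀ τ T (stepPair 𝓡 B₁ (stepPair 𝓟 B₂ B₃)) :=
  refineGB_of_kernelCut_mono h𝓗 hR hE (pairKernelCert_bandHi_stepPair hP)

end Generic

/-! ## §2. The collar cells of record with a generic balance and refit (self-refit of each cell family) -/

section Collar

variable {𝓘₀ 𝓗 𝓡 : ChartFam} {𝓑 : BalPred} {dA dB ℓc τ₁ κ σ : ℝ} {T₁ : SlackTab} {H : HessTab} {F : ForceTab} {X : SlackTab} {B₁ B₂ : PairTab}
  {βf₁ βf₂ βf₃ sf₁ sf₂ sf₃ : (M₀ : ℕ) → (Fin M₀ → E3) → Fin M₀ → ℝ}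

/-- ★★ **(N∣𝔇′)ᴸ FROM THE KERNEL CUT INSIDE THE DOOR FAMILY WITH ANY BALANCE `𝓑` (e.g. `momentBal r`, r1629 (MB)) AND ANY REFIT DATA `(τ₁, T₁)`**, the certificate at the
COLLARED cone `relConeLenBy 2 ℓc βf₁ sf₁ (1/25)`, hull `𝓗 ⊇` the family, any off-door table `B₂` (collar twin of #33's `refineGB_ND_of_kernelCut`; #36's `…_top` is the
`balTop` member). [folklore instantiation: §1 `refineGB_stepPair_of_kernelCut_pos`] -/
theorem refineGB_ND_collar_of_kernelCut (h𝓗 : FamilyLE (famAnd (famAnd 𝓘₀ (Dense dA)) 𝓡) 𝓗)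
    (hR : BalancedRefit (famAnd (famAnd 𝓘₀ (Dense dA)) 𝓡) (famAnd (famAnd 𝓘₀ (Dense dA)) 𝓡) 𝓑 (26 / 5) (1 / 100) (1 / 8) (1 / 25) (constTol (1 / 25)) τ₁ T₁)
    (hE : SlavingEnclosureG (famAnd (famAnd 𝓘₀ (Dense dA)) 𝓡) 𝓑 (26 / 5) (1 / 100) (1 / 8) τ₁ T₁ κ σ H F X)
    (hP : PairKernelCert (famAnd (famAnd 𝓘₀ (Dense dA)) 𝓡) 𝓑 τ₁ T₁ κ σ H F X (1 / 25) (constTol (1 / 25)) (relConeLenBy 2 ℓc βf₁ sf₁ (1 / 25))) :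
    RefineGB (famAnd (famAnd 𝓘₀ (Dense dA)) 𝓡) 𝓗 (26 / 5) (1 / 100) (1 / 8) (1 / 25) (constTol (1 / 25)) (1 / 25) (constTol (1 / 25))
      (stepPair 𝓡 (relConeLenBy 2 ℓc βf₁ sf₁ (1 / 25)) B₂) :=
  refineGB_stepPair_of_kernelCut_pos h𝓗 hR hE hP

/-- ★★ **(N∣𝔅lo) UNDER THE COLLARED DENSE TABLE FROM THE KERNEL CUT INSIDE THE LOW-BAND FAMILY WITH ANY BALANCE AND REFIT**, certificate at its own cone `(βf₂, sf₂)`.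
[folklore instantiation: `refineGB_of_kernelCut_mono` at #36 `pairKernelCert_bandLo_collar_glued`] -/
theorem refineGB_NBlo_collar_of_kernelCut (h𝓗 : FamilyLE (famAnd (famAndNot (famAnd 𝓘₀ (Dense dA)) 𝓡) (Dense dB)) 𝓗)
    (hR : BalancedRefit (famAnd (famAndNot (famAnd 𝓘₀ (Dense dA)) 𝓡) (Dense dB)) (famAnd (famAndNot (famAnd 𝓘₀ (Dense dA)) 𝓡) (Dense dB)) 𝓑 (26 / 5) (1 / 100)
      (1 / 8) (1 / 25) (constTol (1 / 25)) τ₁ T₁)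
    (hE : SlavingEnclosureG (famAnd (famAndNot (famAnd 𝓘₀ (Dense dA)) 𝓡) (Dense dB)) 𝓑 (26 / 5) (1 / 100) (1 / 8) τ₁ T₁ κ σ H F X)
    (hP : PairKernelCert (famAnd (famAndNot (famAnd 𝓘₀ (Dense dA)) 𝓡) (Dense dB)) 𝓑 τ₁ T₁ κ σ H F X (1 / 25) (constTol (1 / 25)) (relConeBy 2 βf₂ sf₂ (1 / 25))) :
    RefineGB (famAnd (famAndNot (famAnd 𝓘₀ (Dense dA)) 𝓡) (Dense dB)) 𝓗 (26 / 5) (1 / 100) (1 / 8) (1 / 25) (constTol (1 / 25)) (1 / 25) (constTol (1 / 25))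
      (stepPair 𝓡 B₁ (relConeBy 2 (stepByF (Dense dB) βf₂ βf₃) (stepByF (Dense dB) sf₂ sf₃) (1 / 25))) :=
  refineGB_of_kernelCut_mono h𝓗 hR hE (pairKernelCert_bandLo_collar_glued hP)

/-- CONSISTENCY: #36's identity-refit member is §2 at `balancedRefit_top`. [formal bookkeeping] -/
example (h𝓗 : FamilyLE (famAnd (famAnd 𝓘₀ (Dense dA)) 𝓡) 𝓗)
    (hE : SlavingEnclosureG (famAnd (famAnd 𝓘₀ (Dense dA)) 𝓡) balTop (26 / 5) (1 / 100) (1 / 8) (1 / 25) (constTol (1 / 25)) κ σ H F X)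
    (hP : PairKernelCert (famAnd (famAnd 𝓘₀ (Dense dA)) 𝓡) balTop (1 / 25) (constTol (1 / 25)) κ σ H F X (1 / 25) (constTol (1 / 25))
      (relConeLenBy 2 ℓc βf₁ sf₁ (1 / 25))) :
    RefineGB (famAnd (famAnd 𝓘₀ (Dense dA)) 𝓡) 𝓗 (26 / 5) (1 / 100) (1 / 8) (1 / 25) (constTol (1 / 25)) (1 / 25) (constTol (1 / 25))
      (stepPair 𝓡 (relConeLenBy 2 ℓc βf₁ sf₁ (1 / 25)) B₂) :=
  refineGB_ND_collar_of_kernelCut h𝓗 (balancedRefit_top (familyLE_refl _)) hE hP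

end Collar

/-! ## §3. ★★★ The 27623 consumers with BOTH instrumented N-cells at a generic balance / refit -/

section Consumers

variable {𝓘₀ 𝓗 𝓘 𝓡 : ChartFam} {𝓑 𝓑' : BalPred} {dA dB ℓc τ₁ τ₁' κ κ' σ σ' : ℝ} {T₁ T₁' : SlackTab} {H H' : HessTab} {F F' : ForceTab} {X X' : SlackTab}
  {B₁ B₂ B₃ : PairTab} {βf₁ βf₂ βf₃ sf₁ sf₂ sf₃ : (M₀ : ℕ) → (Fin M₀ → E3) → Fin M₀ → ℝ}

/-- ★★★ **(F₆′) under (α), QUOTIENT CURRENCY, COLLARED FOUR SECTORS, (N∣𝔇′)ᴸ AND (N∣𝔅lo) FROM KERNEL CUTS WITH GENERIC BALANCES `𝓑`, `𝓑′` AND REFITS `(τ₁, T₁)`, `(τ₁′, T₁′)`**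
(each a self-refit of its cell family; r1629 (MB): take `𝓑 := momentBal r`) — otherwise literally #37 §3. [folklore instantiation: #37 `…_collar_…` at §2] -/
theorem aperiodicFrustratedLawGap_of_semOKF_semOKHQ_fourSector_collar_kernelCut_A35000_T26_record {εE CE DE DX : ℝ}
    (hε0 : 0 < εE) (hε1 : εE ≤ 1 / 10000) (hDX : 0 ≤ DX)
    (hE : SchurElasticPricingX (1 / 20) (1 / 8) w₄₅ ω₄ (3 / 400) (-(7175 / 10000)) (1 / 10000) CE DE DX (LocOptFails eStar εE (3 / 2) 1))
    (hFcc : semOKF (-399210329969189) rootC rootW = true)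
    (hHcp : semOKHQ (-399210329969189) rootCHQ rootWHQ = true)
    (hT : ∀ (M : ℕ) (z : Fin M → E3) (c : Fin M), Admissible M z c → CleanBall (63 / 10) z c → MonoPhaseBall (63 / 10) z c →
      NearHomIsoAt (26 / 5) (1 / 100) z c → -(13 / 50000) ≤ ballAvg (9 / 5) z (tailOut (26 / 5) M z c) c)
    (hR : CoreCoreRelief (63 / 10) (63 / 10) (26 / 5) (1 / 100) (3 / 5000))
    (hED : TubeFloorGBLenBy (famAnd (famAnd 𝓘 (Dense dA)) 𝓡) ℓc βf₁ sf₁)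
    (hEBlo : TubeFloorGB (famAnd (famAndNot (famAnd 𝓘 (Dense dA)) 𝓡) (Dense dB)) (1 / 25) (constTol (1 / 25)) (relConeBy 2 βf₂ sf₂ (1 / 25)))
    (hEBhi : TubeFloorGB (famAndNot (famAndNot (famAnd 𝓘 (Dense dA)) 𝓡) (Dense dB)) (1 / 25) (constTol (1 / 25)) (relConeBy 2 βf₃ sf₃ (1 / 25)))
    (hEA : TubeFloor (famAndNot 𝓘 (Dense dA)) (1 / 25))
    (hK : FamilyCoverGRecAt 𝓘₀ (26 / 5) (1 / 100))
    (h𝓗D : FamilyLE (famAnd (famAnd 𝓘₀ (Dense dA)) 𝓡) 𝓗)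
    (hRD : BalancedRefit (famAnd (famAnd 𝓘₀ (Dense dA)) 𝓡) (famAnd (famAnd 𝓘₀ (Dense dA)) 𝓡) 𝓑 (26 / 5) (1 / 100) (1 / 8) (1 / 25) (constTol (1 / 25)) τ₁ T₁)
    (hEncD : SlavingEnclosureG (famAnd (famAnd 𝓘₀ (Dense dA)) 𝓡) 𝓑 (26 / 5) (1 / 100) (1 / 8) τ₁ T₁ κ σ H F X)
    (hPD : PairKernelCert (famAnd (famAnd 𝓘₀ (Dense dA)) 𝓡) 𝓑 τ₁ T₁ κ σ H F X (1 / 25) (constTol (1 / 25)) (relConeLenBy 2 ℓc βf₁ sf₁ (1 / 25)))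
    (h𝓗Blo : FamilyLE (famAnd (famAndNot (famAnd 𝓘₀ (Dense dA)) 𝓡) (Dense dB)) 𝓗)
    (hRBlo : BalancedRefit (famAnd (famAndNot (famAnd 𝓘₀ (Dense dA)) 𝓡) (Dense dB)) (famAnd (famAndNot (famAnd 𝓘₀ (Dense dA)) 𝓡) (Dense dB)) 𝓑' (26 / 5) (1 / 100)
      (1 / 8) (1 / 25) (constTol (1 / 25)) τ₁' T₁')
    (hEncBlo : SlavingEnclosureG (famAnd (famAndNot (famAnd 𝓘₀ (Dense dA)) 𝓡) (Dense dB)) 𝓑' (26 / 5) (1 / 100) (1 / 8) τ₁' T₁' κ' σ' H' F' X')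
    (hPBlo : PairKernelCert (famAnd (famAndNot (famAnd 𝓘₀ (Dense dA)) 𝓡) (Dense dB)) 𝓑' τ₁' T₁' κ' σ' H' F' X' (1 / 25) (constTol (1 / 25)) (relConeBy 2 βf₂ sf₂ (1 / 25)))
    (hNBhi : RefineGB (famAndNot (famAndNot (famAnd 𝓘₀ (Dense dA)) 𝓡) (Dense dB)) 𝓗 (26 / 5) (1 / 100) (1 / 8) (1 / 25) (constTol (1 / 25)) (1 / 25)
      (constTol (1 / 25)) (stepPair 𝓡 (relConeLenBy 2 ℓc βf₁ sf₁ (1 / 25)) (relConeBy 2 (stepByF (Dense dB) βf₂ βf₃) (stepByF (Dense dB) sf₂ sf₃) (1 / 25))))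
    (h𝓗 : FamilyLE (famAndNot 𝓘₀ (Dense dA)) 𝓗)
    (hcap : PairLE (stepPair 𝓡 (relConeLenBy 2 ℓc βf₁ sf₁ (1 / 25)) (relConeBy 2 (stepByF (Dense dB) βf₂ βf₃) (stepByF (Dense dB) sf₂ sf₃) (1 / 25)))
      (pairSum (constTol (1 / 25))))
    (h𝓘 : FamilyLE 𝓗 𝓘)
    (hF : AnnularPhaseFloor (63 / 10) (24 / 5) (63 / 10) (1 / 1000)) (hP : PolyTextureFloor (63 / 10) (24 / 5) (1 / 1000))
    (hA : AnnularDefectFloor (24 / 5) (63 / 10)) (hD : DefectiveCollarFloor (24 / 5))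
    (h2 : CrowdedCoreMotifPricingCapK (1 / 1000) (9 / 5) (133 / 10) (3 / 2) (effPot w₄₅ ω₄ (3 / 400)) (-(7175 / 10000) + 3 / 400)
      (Collar (9 / 2) fun N y j => (∃ s : ℝ, 0 ≤ s ∧ s ≤ 3 / 2 ∧ NonEquilibriumCore (-(7175 / 10000)) 0 7 s (1 / 10000) N y j) ∨
        GoodAtScale (1 / 20) (3 / 2) y j))
    (h3 : DiluteDefectMotifPricingCapK (1 / 1000) (9 / 5) (133 / 10) (3 / 2) (effPot w₄₅ ω₄ (3 / 400)) (-(7175 / 10000) + 3 / 400)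
      (Collar (9 / 2) fun N y j => (∃ s : ℝ, 0 ≤ s ∧ s ≤ 3 / 2 ∧ NonEquilibriumCore (-(7175 / 10000)) 0 7 s (1 / 10000) N y j) ∨
        GoodAtScale (1 / 20) (3 / 2) y j)) :
    Summit.AtomisticToContinuum.Crystallization.Theses.FrustratedLawDichotomy.AperiodicFrustratedLawGap :=
  aperiodicFrustratedLawGap_of_semOKF_semOKHQ_fourSector_collar_A35000_T26_record hε0 hε1 hDX hE hFcc hHcp hT hR hED hEBlo hEBhi hEA hK
    (refineGB_ND_collar_of_kernelCut h𝓗D hRD hEncD hPD) (refineGB_NBlo_collar_of_kernelCut h𝓗Blo hRBlo hEncBlo hPBlo) hNBhi h𝓗 hcap h𝓘 hF hP hA hD h2 h3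

/-- ★★★ **… AT THREE GENERIC DENSE TABLES** `B₁/B₂/B₃` (certificates at `B₁` on the door family and at `B₂` on the low band; #39 §2 otherwise). [folklore instantiation:
#39 `…_stepPair_…` at §1] -/
theorem aperiodicFrustratedLawGap_of_semOKF_semOKHQ_fourSector_stepPair_kernelCut_A35000_T26_record {εE CE DE DX : ℝ}
    (hε0 : 0 < εE) (hε1 : εE ≤ 1 / 10000) (hDX : 0 ≤ DX)
    (hE : SchurElasticPricingX (1 / 20) (1 / 8) w₄₅ ω₄ (3 / 400) (-(7175 / 10000)) (1 / 10000) CE DE DX (LocOptFails eStar εE (3 / 2) 1))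
    (hFcc : semOKF (-399210329969189) rootC rootW = true)
    (hHcp : semOKHQ (-399210329969189) rootCHQ rootWHQ = true)
    (hT : ∀ (M : ℕ) (z : Fin M → E3) (c : Fin M), Admissible M z c → CleanBall (63 / 10) z c → MonoPhaseBall (63 / 10) z c →
      NearHomIsoAt (26 / 5) (1 / 100) z c → -(13 / 50000) ≤ ballAvg (9 / 5) z (tailOut (26 / 5) M z c) c)
    (hR : CoreCoreRelief (63 / 10) (63 / 10) (26 / 5) (1 / 100) (3 / 5000))
    (hED : TubeFloorGB (famAnd (famAnd 𝓘 (Dense dA)) 𝓡) (1 / 25) (constTol (1 / 25)) B₁)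
    (hEBlo : TubeFloorGB (famAnd (famAndNot (famAnd 𝓘 (Dense dA)) 𝓡) (Dense dB)) (1 / 25) (constTol (1 / 25)) B₂)
    (hEBhi : TubeFloorGB (famAndNot (famAndNot (famAnd 𝓘 (Dense dA)) 𝓡) (Dense dB)) (1 / 25) (constTol (1 / 25)) B₃)
    (hEA : TubeFloor (famAndNot 𝓘 (Dense dA)) (1 / 25))
    (hK : FamilyCoverGRecAt 𝓘₀ (26 / 5) (1 / 100))
    (h𝓗D : FamilyLE (famAnd (famAnd 𝓘₀ (Dense dA)) 𝓡) 𝓗)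
    (hRD : BalancedRefit (famAnd (famAnd 𝓘₀ (Dense dA)) 𝓡) (famAnd (famAnd 𝓘₀ (Dense dA)) 𝓡) 𝓑 (26 / 5) (1 / 100) (1 / 8) (1 / 25) (constTol (1 / 25)) τ₁ T₁)
    (hEncD : SlavingEnclosureG (famAnd (famAnd 𝓘₀ (Dense dA)) 𝓡) 𝓑 (26 / 5) (1 / 100) (1 / 8) τ₁ T₁ κ σ H F X)
    (hPD : PairKernelCert (famAnd (famAnd 𝓘₀ (Dense dA)) 𝓡) 𝓑 τ₁ T₁ κ σ H F X (1 / 25) (constTol (1 / 25)) B₁)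
    (h𝓗Blo : FamilyLE (famAnd (famAndNot (famAnd 𝓘₀ (Dense dA)) 𝓡) (Dense dB)) 𝓗)
    (hRBlo : BalancedRefit (famAnd (famAndNot (famAnd 𝓘₀ (Dense dA)) 𝓡) (Dense dB)) (famAnd (famAndNot (famAnd 𝓘₀ (Dense dA)) 𝓡) (Dense dB)) 𝓑' (26 / 5) (1 / 100)
      (1 / 8) (1 / 25) (constTol (1 / 25)) τ₁' T₁')
    (hEncBlo : SlavingEnclosureG (famAnd (famAndNot (famAnd 𝓘₀ (Dense dA)) 𝓡) (Dense dB)) 𝓑' (26 / 5) (1 / 100) (1 / 8) τ₁' T₁' κ' σ' H' F' X')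
    (hPBlo : PairKernelCert (famAnd (famAndNot (famAnd 𝓘₀ (Dense dA)) 𝓡) (Dense dB)) 𝓑' τ₁' T₁' κ' σ' H' F' X' (1 / 25) (constTol (1 / 25)) B₂)
    (hNBhi : RefineGB (famAndNot (famAndNot (famAnd 𝓘₀ (Dense dA)) 𝓡) (Dense dB)) 𝓗 (26 / 5) (1 / 100) (1 / 8) (1 / 25) (constTol (1 / 25)) (1 / 25)
      (constTol (1 / 25)) (stepPair 𝓡 B₁ (stepPair (Dense dB) B₂ B₃)))
    (h𝓗 : FamilyLE (famAndNot 𝓘₀ (Dense dA)) 𝓗)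
    (hcap : PairLE (stepPair 𝓡 B₁ (stepPair (Dense dB) B₂ B₃))
      (pairSum (constTol (1 / 25))))
    (h𝓘 : FamilyLE 𝓗 𝓘)
    (hF : AnnularPhaseFloor (63 / 10) (24 / 5) (63 / 10) (1 / 1000)) (hP : PolyTextureFloor (63 / 10) (24 / 5) (1 / 1000))
    (hA : AnnularDefectFloor (24 / 5) (63 / 10)) (hD : DefectiveCollarFloor (24 / 5))
    (h2 : CrowdedCoreMotifPricingCapK (1 / 1000) (9 / 5) (133 / 10) (3 / 2) (effPot w₄₅ ω₄ (3 / 400)) (-(7175 / 10000) + 3 / 400)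
      (Collar (9 / 2) fun N y j => (∃ s : ℝ, 0 ≤ s ∧ s ≤ 3 / 2 ∧ NonEquilibriumCore (-(7175 / 10000)) 0 7 s (1 / 10000) N y j) ∨
        GoodAtScale (1 / 20) (3 / 2) y j))
    (h3 : DiluteDefectMotifPricingCapK (1 / 1000) (9 / 5) (133 / 10) (3 / 2) (effPot w₄₅ ω₄ (3 / 400)) (-(7175 / 10000) + 3 / 400)
      (Collar (9 / 2) fun N y j => (∃ s : ℝ, 0 ≤ s ∧ s ≤ 3 / 2 ∧ NonEquilibriumCore (-(7175 / 10000)) 0 7 s (1 / 10000) N y j) ∨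
        GoodAtScale (1 / 20) (3 / 2) y j)) :
    Summit.AtomisticToContinuum.Crystallization.Theses.FrustratedLawDichotomy.AperiodicFrustratedLawGap :=
  aperiodicFrustratedLawGap_of_semOKF_semOKHQ_fourSector_stepPair_A35000_T26_record hε0 hε1 hDX hE hFcc hHcp hT hR hED hEBlo hEBhi hEA hK
    (refineGB_stepPair_of_kernelCut_pos h𝓗D hRD hEncD hPD) (refineGB_bandLo_stepPair_of_kernelCut h𝓗Blo hRBlo hEncBlo hPBlo) hNBhi h𝓗 hcap h𝓘 hF hP hA hD
    h2 h3

end Consumers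

/-! ## §4. Refit TARGET generic — the DOOR T shape of lens-5 g102 «RefitCut» (appended, hand-2 g43)

FINDING REFIT-102: least squares over the record bent family refits the cell family `𝓘_N` into a DIFFERENT, window-honest target family `𝓘ʷ` (DOOR T: `BalancedRefit 𝓘_N 𝓘ʷ (bentBal …) …`)
or keeps the family with a slack balance (DOOR S).  §1 is already source-, balance- and refit-generic; here the TARGET is freed in the record-literal collar cells and in the
consumer: the certificate and the enclosure live on the target `famAnd 𝓙 𝓡` (door) / `famAnd (famAndNot (famAnd 𝓙′ (Dense dA)) 𝓡) (Dense dB)` (low band) for ANY `𝓙`, `𝓙′`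
(self-refit = §2/§3 at `𝓙 := famAnd 𝓘₀ (Dense dA)`, `𝓙′ := 𝓘₀`).
-/

section Target

variable {𝓘₀ 𝓗 𝓘 𝓡 𝓙 𝓙' : ChartFam} {𝓑 𝓑' : BalPred} {dA dB ℓc τ₁ τ₁' κ κ' σ σ' : ℝ} {T₁ T₁' : SlackTab} {H H' : HessTab} {F F' : ForceTab}
  {X X' : SlackTab} {B₁ B₂ : PairTab} {βf₁ βf₂ βf₃ sf₁ sf₂ sf₃ : (M₀ : ℕ) → (Fin M₀ → E3) → Fin M₀ → ℝ}

/-- ★★ **(N∣𝔇′)ᴸ BY REFITTING THE DOOR CELL FAMILY INTO ANY TARGET `famAnd 𝓙 𝓡`** (balance `𝓑`, data `(τ₁, T₁)`), the enclosure and the certificate at the COLLARED cone on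
the target, hull `𝓗 ⊇ famAnd 𝓙 𝓡`. [folklore instantiation: §1 `refineGB_stepPair_of_kernelCut_pos`] -/
theorem refineGB_ND_collar_of_kernelCut_target (h𝓗 : FamilyLE (famAnd 𝓙 𝓡) 𝓗)
    (hR : BalancedRefit (famAnd (famAnd 𝓘₀ (Dense dA)) 𝓡) (famAnd 𝓙 𝓡) 𝓑 (26 / 5) (1 / 100) (1 / 8) (1 / 25) (constTol (1 / 25)) τ₁ T₁)
    (hE : SlavingEnclosureG (famAnd 𝓙 𝓡) 𝓑 (26 / 5) (1 / 100) (1 / 8) τ₁ T₁ κ σ H F X)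
    (hP : PairKernelCert (famAnd 𝓙 𝓡) 𝓑 τ₁ T₁ κ σ H F X (1 / 25) (constTol (1 / 25)) (relConeLenBy 2 ℓc βf₁ sf₁ (1 / 25))) :
    RefineGB (famAnd (famAnd 𝓘₀ (Dense dA)) 𝓡) 𝓗 (26 / 5) (1 / 100) (1 / 8) (1 / 25) (constTol (1 / 25)) (1 / 25) (constTol (1 / 25))
      (stepPair 𝓡 (relConeLenBy 2 ℓc βf₁ sf₁ (1 / 25)) B₂) :=
  refineGB_stepPair_of_kernelCut_pos h𝓗 hR hE hP

/-- ★★ **(N∣𝔅lo) BY REFITTING THE LOW-BAND CELL FAMILY INTO ANY TARGET OF THE SAME CLASS SHAPE** `famAnd (famAndNot (famAnd 𝓙′ (Dense dA)) 𝓡) (Dense dB)`, certificate at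
its own cone `(βf₂, sf₂)` under the collared dense table. [folklore instantiation: `refineGB_of_kernelCut_mono` at #36 `pairKernelCert_bandLo_collar_glued`] -/
theorem refineGB_NBlo_collar_of_kernelCut_target (h𝓗 : FamilyLE (famAnd (famAndNot (famAnd 𝓙' (Dense dA)) 𝓡) (Dense dB)) 𝓗)
    (hR : BalancedRefit (famAnd (famAndNot (famAnd 𝓘₀ (Dense dA)) 𝓡) (Dense dB)) (famAnd (famAndNot (famAnd 𝓙' (Dense dA)) 𝓡) (Dense dB)) 𝓑 (26 / 5) (1 / 100)
      (1 / 8) (1 / 25) (constTol (1 / 25)) τ₁ T₁)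
    (hE : SlavingEnclosureG (famAnd (famAndNot (famAnd 𝓙' (Dense dA)) 𝓡) (Dense dB)) 𝓑 (26 / 5) (1 / 100) (1 / 8) τ₁ T₁ κ σ H F X)
    (hP : PairKernelCert (famAnd (famAndNot (famAnd 𝓙' (Dense dA)) 𝓡) (Dense dB)) 𝓑 τ₁ T₁ κ σ H F X (1 / 25) (constTol (1 / 25))
      (relConeBy 2 βf₂ sf₂ (1 / 25))) :
    RefineGB (famAnd (famAndNot (famAnd 𝓘₀ (Dense dA)) 𝓡) (Dense dB)) 𝓗 (26 / 5) (1 / 100) (1 / 8) (1 / 25) (constTol (1 / 25)) (1 / 25) (constTol (1 / 25))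
      (stepPair 𝓡 B₁ (relConeBy 2 (stepByF (Dense dB) βf₂ βf₃) (stepByF (Dense dB) sf₂ sf₃) (1 / 25))) :=
  refineGB_of_kernelCut_mono h𝓗 hR hE (pairKernelCert_bandLo_collar_glued hP)

/-- ★★★ **(F₆′) under (α), QUOTIENT CURRENCY, COLLARED FOUR SECTORS, (N∣𝔇′)ᴸ AND (N∣𝔅lo) BY REFITS INTO GENERIC TARGETS** (DOOR T: `𝓙 := famAnd 𝓘ʷ (Dense dA)`, `𝓑 := bentBal …`;
DOOR S: self-targets with a slack balance) — otherwise literally §3. [folklore instantiation: #37 `…_collar_…` at §4] -/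
theorem aperiodicFrustratedLawGap_of_semOKF_semOKHQ_fourSector_collar_kernelCutT_A35000_T26_record {εE CE DE DX : ℝ}
    (hε0 : 0 < εE) (hε1 : εE ≤ 1 / 10000) (hDX : 0 ≤ DX)
    (hE : SchurElasticPricingX (1 / 20) (1 / 8) w₄₅ ω₄ (3 / 400) (-(7175 / 10000)) (1 / 10000) CE DE DX (LocOptFails eStar εE (3 / 2) 1))
    (hFcc : semOKF (-399210329969189) rootC rootW = true)
    (hHcp : semOKHQ (-399210329969189) rootCHQ rootWHQ = true)
    (hT : ∀ (M : ℕ) (z : Fin M → E3) (c : Fin M), Admissible M z c → CleanBall (63 / 10) z c → MonoPhaseBall (63 / 10) z c →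
      NearHomIsoAt (26 / 5) (1 / 100) z c → -(13 / 50000) ≤ ballAvg (9 / 5) z (tailOut (26 / 5) M z c) c)
    (hR : CoreCoreRelief (63 / 10) (63 / 10) (26 / 5) (1 / 100) (3 / 5000))
    (hED : TubeFloorGBLenBy (famAnd (famAnd 𝓘 (Dense dA)) 𝓡) ℓc βf₁ sf₁)
    (hEBlo : TubeFloorGB (famAnd (famAndNot (famAnd 𝓘 (Dense dA)) 𝓡) (Dense dB)) (1 / 25) (constTol (1 / 25)) (relConeBy 2 βf₂ sf₂ (1 / 25)))
    (hEBhi : TubeFloorGB (famAndNot (famAndNot (famAnd 𝓘 (Dense dA)) 𝓡) (Dense dB)) (1 / 25) (constTol (1 / 25)) (relConeBy 2 βf₃ sf₃ (1 / 25)))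
    (hEA : TubeFloor (famAndNot 𝓘 (Dense dA)) (1 / 25))
    (hK : FamilyCoverGRecAt 𝓘₀ (26 / 5) (1 / 100))
    (h𝓗D : FamilyLE (famAnd 𝓙 𝓡) 𝓗)
    (hRD : BalancedRefit (famAnd (famAnd 𝓘₀ (Dense dA)) 𝓡) (famAnd 𝓙 𝓡) 𝓑 (26 / 5) (1 / 100) (1 / 8) (1 / 25) (constTol (1 / 25)) τ₁ T₁)
    (hEncD : SlavingEnclosureG (famAnd 𝓙 𝓡) 𝓑 (26 / 5) (1 / 100) (1 / 8) τ₁ T₁ κ σ H F X)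
    (hPD : PairKernelCert (famAnd 𝓙 𝓡) 𝓑 τ₁ T₁ κ σ H F X (1 / 25) (constTol (1 / 25)) (relConeLenBy 2 ℓc βf₁ sf₁ (1 / 25)))
    (h𝓗Blo : FamilyLE (famAnd (famAndNot (famAnd 𝓙' (Dense dA)) 𝓡) (Dense dB)) 𝓗)
    (hRBlo : BalancedRefit (famAnd (famAndNot (famAnd 𝓘₀ (Dense dA)) 𝓡) (Dense dB)) (famAnd (famAndNot (famAnd 𝓙' (Dense dA)) 𝓡) (Dense dB)) 𝓑' (26 / 5) (1 / 100)
      (1 / 8) (1 / 25) (constTol (1 / 25)) τ₁' T₁')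
    (hEncBlo : SlavingEnclosureG (famAnd (famAndNot (famAnd 𝓙' (Dense dA)) 𝓡) (Dense dB)) 𝓑' (26 / 5) (1 / 100) (1 / 8) τ₁' T₁' κ' σ' H' F' X')
    (hPBlo : PairKernelCert (famAnd (famAndNot (famAnd 𝓙' (Dense dA)) 𝓡) (Dense dB)) 𝓑' τ₁' T₁' κ' σ' H' F' X' (1 / 25) (constTol (1 / 25))
      (relConeBy 2 βf₂ sf₂ (1 / 25)))
    (hNBhi : RefineGB (famAndNot (famAndNot (famAnd 𝓘₀ (Dense dA)) 𝓡) (Dense dB)) 𝓗 (26 / 5) (1 / 100) (1 / 8) (1 / 25) (constTol (1 / 25)) (1 / 25)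
      (constTol (1 / 25)) (stepPair 𝓡 (relConeLenBy 2 ℓc βf₁ sf₁ (1 / 25)) (relConeBy 2 (stepByF (Dense dB) βf₂ βf₃) (stepByF (Dense dB) sf₂ sf₃) (1 / 25))))
    (h𝓗 : FamilyLE (famAndNot 𝓘₀ (Dense dA)) 𝓗)
    (hcap : PairLE (stepPair 𝓡 (relConeLenBy 2 ℓc βf₁ sf₁ (1 / 25)) (relConeBy 2 (stepByF (Dense dB) βf₂ βf₃) (stepByF (Dense dB) sf₂ sf₃) (1 / 25)))
      (pairSum (constTol (1 / 25))))
    (h𝓘 : FamilyLE 𝓗 𝓘)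
    (hF : AnnularPhaseFloor (63 / 10) (24 / 5) (63 / 10) (1 / 1000)) (hP : PolyTextureFloor (63 / 10) (24 / 5) (1 / 1000))
    (hA : AnnularDefectFloor (24 / 5) (63 / 10)) (hD : DefectiveCollarFloor (24 / 5))
    (h2 : CrowdedCoreMotifPricingCapK (1 / 1000) (9 / 5) (133 / 10) (3 / 2) (effPot w₄₅ ω₄ (3 / 400)) (-(7175 / 10000) + 3 / 400)
      (Collar (9 / 2) fun N y j => (∃ s : ℝ, 0 ≤ s ∧ s ≤ 3 / 2 ∧ NonEquilibriumCore (-(7175 / 10000)) 0 7 s (1 / 10000) N y j) ∨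
        GoodAtScale (1 / 20) (3 / 2) y j))
    (h3 : DiluteDefectMotifPricingCapK (1 / 1000) (9 / 5) (133 / 10) (3 / 2) (effPot w₄₅ ω₄ (3 / 400)) (-(7175 / 10000) + 3 / 400)
      (Collar (9 / 2) fun N y j => (∃ s : ℝ, 0 ≤ s ∧ s ≤ 3 / 2 ∧ NonEquilibriumCore (-(7175 / 10000)) 0 7 s (1 / 10000) N y j) ∨
        GoodAtScale (1 / 20) (3 / 2) y j)) :
    Summit.AtomisticToContinuum.Crystallization.Theses.FrustratedLawDichotomy.AperiodicFrustratedLawGap :=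
  aperiodicFrustratedLawGap_of_semOKF_semOKHQ_fourSector_collar_A35000_T26_record hε0 hε1 hDX hE hFcc hHcp hT hR hED hEBlo hEBhi hEA hK
    (refineGB_ND_collar_of_kernelCut_target h𝓗D hRD hEncD hPD) (refineGB_NBlo_collar_of_kernelCut_target h𝓗Blo hRBlo hEncBlo hPBlo) hNBhi h𝓗 hcap h𝓘 hF hP
    hA hD h2 h3

end Target

end Summit.AtomisticToContinuum.Crystallization.Theorems.FrustratedLawDichotomyAperiodicGapRecordJunctionStepPairKernelCut

end
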